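import Summits.HodgeConjecture.CorCM.CyclicSexticInducedType
import Literature.AlgebraicGeometry.ComplexMultiplication.ShimuraIsogenousPowerOfRiemann
import HarnessLib

/-!
# COR-CM — faces of a cyclic sextic CM field: the Weil-type count of the corner pair `(Ψ_{j₁}; Φ₀)`

HONEST FRAMING (cell `pub-hodgecm2` / COR-CM, seat b24 gen 9; COUNT-NEUTRAL — no binder row of
`HOME/BINDER-OWNERS.md` is touched; no case of the Hodge conjecture is proved and nothing about algebraic cycles is
asserted; the one existence statement is CONDITIONAL on the displayed `HodgeTheory.DeligneMilne1982_Thm_6_20_full`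
(`hR`, binder B02) and `PicardCM.CMAbelianVarietyRealised` (`h₃`)).  Sequel of `CorCM/CyclicSexticInducedType.lean` /
`…InducedCornerCurve.lean`; step L3 of `HOME/pub-hodgecm2-lit-andre-3/A1-BLUEPRINT.md`, the CM-type input of
`CorCM/WeilFourfoldOfMarkmanPlane.lean` (`WeilFourfold.isWeilType_cmThreefold_biprod_cmCurve`, hypothesis `hcount`).

Let `K` be a Galois CM field with `[K:ℚ] = 6`, `σ` a generator of `Gal(K/ℚ)` (`orderOf σ = 6`, `σ³ = ρ`,
`CyclicSextic.exists_generator`), `k = K^{⟨σ²⟩}` its imaginary quadratic subfield.  For a quadruple of CM types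
`Ψ₀,…,Ψ₃` with `Σⱼ 1_{Ψⱼ} ≡ 2` (`SumTwo`) in configuration (F) of `CyclicSextic.sumTwo_pattern` — `Ψ_{j₀}`
induced from the type `Φ₀` of `k`, the other three the twists `Ψ_{j₁}`, `Ψ_{j₁}∘σ²`, `Ψ_{j₁}∘σ⁴` — this file proves:

* `filter_comp_algebraMap_eq_image` — the extensions to `K` of `s₀|_k` are `s₀, s₀∘σ², s₀∘σ⁴`;
* `weilTypeCount_of_pattern` — the TYPE COUNT `#{s ∈ Ψ_{j₁} : s|_k = τ} + [τ ∈ Φ₀] = 2` for every `τ : k → ℂ`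
  (the constant sum `2` at an extension `s₀` of `τ`, read through the pattern) — Deligne 1982 §5 (c) for the pair
  `(Ψ_{j₁}; Φ₀)`: the hypothesis under which `A_{Ψ_{j₁}} × E_{Φ₀}` is a fourfold of Weil type for `k`;
* `exists_inducedType_cmCurve_isogeny_of_sq_stable` — the companion of
  `CyclicSextic.exists_cmCurve_isogeny_of_sq_stable` that RETAINS the equation `Ψ = inducedCMType (k → K) Φ₀` (so
  that the count applies to the same `Φ₀`): a realisation of a `σ²`-stable type is `𝓞_k`-isogenous to a power of a CM
  elliptic curve `E ⊨ (k; Φ₀)` (Shimura's Thm. 3, kernel theorem modulo `hR`, `h₃`).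

THEOREMS ONLY; no `sorry`; axioms `propext`, `Classical.choice`, `Quot.sound`.  NOT here: twist isogenies between
the primitive corners, face monomials, pull-backs, `weilLineClasses` (A1 steps L2/L4/L5/L6, other seats).

## References
* [Deligne1982HodgeCycles] P. Deligne (notes by J. S. Milne), LNM 900 (1982), §4 Prop. 4.4, §5 (c).
* [Shimura1998] G. Shimura, *Abelian Varieties with Complex Multiplication and Modular Functions* (1998), §6.2
  Thm. 3, §8.2.
-/

noncomputable section

namespace Summit.HodgeConjecture.CorCM.CyclicSextic

open CategoryTheory CategoryTheory.Limits NumberField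
open Literature.AlgebraicGeometry.Motives (CMType AbelianVariety)
open Literature.AlgebraicGeometry.HodgeTheory (complexBetti DeligneMilne1982_Thm_6_20_full)
open Literature.AlgebraicGeometry.ComplexMultiplication (IsCMTypeRealisation thm3_isogenousPower_of_riemann)
open Literature.NumberTheory.ComplexMultiplication (conjGal inducedCMType mem_inducedCMType_iff)
open Literature.NumberTheory.Automorphic.PicardCM (CMAbelianVarietyRealised)
open Literature.NumberTheory.Automorphic.PicardCM.CMCode (cmTypeMap mem_cmTypeMap_iff)

variable {K : Type} [Field K] [NumberField K] [IsCMField K] [IsGalois ℚ K] (σ : K ≃ₐ[ℚ] K)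

/-! ## §1 The fibres of `Hom(K, ℂ) → Hom(k, ℂ)` -/

omit [IsCMField K] in
open scoped Classical in
/-- **The extensions of `s₀|_k` to `K` are `s₀, s₀∘σ², s₀∘σ⁴`** (`k = K^{⟨σ²⟩}`, `orderOf σ = 6`): every
extension is `s₀ ∘ (σ²)ⁿ` (`exists_pow_sq_of_comp_algebraMap_eq`) with `n` taken mod `3 = orderOf σ²`.
[folklore] -/
theorem filter_comp_algebraMap_eq_image (hσ : orderOf σ = 6) (s₀ : K →+* ℂ) :
    (Finset.univ.filter fun s : K →+* ℂ =>
        s.comp (algebraMap (IntermediateField.fixedField (Subgroup.zpowers (σ ^ 2))) K) =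
          s₀.comp (algebraMap (IntermediateField.fixedField (Subgroup.zpowers (σ ^ 2))) K)) =
      (Finset.range 3).image fun n => s₀.comp ((σ ^ 2) ^ n).toRingEquiv.toRingHom := by
  ext s
  simp only [Finset.mem_filter, Finset.mem_univ, true_and, Finset.mem_image, Finset.mem_range]
  constructor
  · intro hs
    obtain ⟨n, rfl⟩ := exists_pow_sq_of_comp_algebraMap_eq σ s₀ s hs.symm
    refine ⟨n % 3, Nat.mod_lt _ (by norm_num), ?_⟩
    have h3 : (σ ^ 2) ^ (n % 3) = (σ ^ 2) ^ n := by rw [← orderOf_sq σ hσ, pow_mod_orderOf]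
    rw [h3]
  · rintro ⟨n, -, rfl⟩
    exact comp_pow_sq_comp_algebraMap σ s₀ n

omit [IsCMField K] in
/-- `n ↦ s₀ ∘ (σ²)ⁿ` is injective on `{0, 1, 2}` (embeddings form a `Gal`-torsor; `orderOf σ² = 3`). [folklore] -/
theorem injOn_comp_pow_sq (hσ : orderOf σ = 6) (s₀ : K →+* ℂ) :
    Set.InjOn (fun n : ℕ => s₀.comp ((σ ^ 2) ^ n).toRingEquiv.toRingHom) ↑(Finset.range 3) := by
  intro a ha b hb hab
  have hab' : (σ ^ 2) ^ a = (σ ^ 2) ^ b := (AndreProductForm.comp_gal_bijective K s₀).1 hab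
  rw [Finset.coe_range, Set.mem_Iio] at ha hb
  have ha' : a ∈ Set.Iio (orderOf (σ ^ 2)) := by rw [orderOf_sq σ hσ]; exact ha
  have hb' : b ∈ Set.Iio (orderOf (σ ^ 2)) := by rw [orderOf_sq σ hσ]; exact hb
  exact pow_injOn_Iio_orderOf ha' hb' hab'

/-! ## §2 The type count in configuration (F) -/

omit [NumberField K] [IsCMField K] [IsGalois ℚ K] in
open scoped Classical in
/-- `ind Φ φ` (an integer) is the cast of the natural-number indicator. [folklore] -/
theorem ind_eq_natCast_ite (Φ : CMType K) (φ : K →+* ℂ) :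
    ind Φ φ = ((if φ ∈ Φ.1 then 1 else 0 : ℕ) : ℤ) := by
  by_cases h : φ ∈ Φ.1
  · rw [ind_of_mem h, if_pos h]; rfl
  · rw [ind_of_not_mem h, if_neg h]; rfl

omit [IsCMField K] in
open scoped Classical in
/-- **The type count in configuration (F).** `K` Galois CM sextic, `σ` of order `6` with `σ³ = ρ`,
`k = K^{⟨σ²⟩}`; `Ψ₀,…,Ψ₃` CM types with `Σⱼ 1_{Ψⱼ} ≡ 2`, indexed so that `Ψ_{j₀} = Ind_k^K Φ₀` is induced from
the type `Φ₀` of `k` and `Ψ_{j₂} = Ψ_{j₁}∘σ²`, `Ψ_{j₃} = Ψ_{j₁}∘σ⁴` (`{j₀,…,j₃} = {0,…,3}`; the output of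
`sumTwo_pattern`, case (F), with `exists_inducedCMType_of_sq_stable`).  Then for every `τ : k → ℂ`:
`#{s : K → ℂ | s|_k = τ, s ∈ Ψ_{j₁}} + [τ ∈ Φ₀] = 2` — the constant sum evaluated at an extension `s₀` of `τ`,
whose fibre is `{s₀, s₀σ², s₀σ⁴}`.  (Deligne 1982 §5 (c): `Σ Φᵢ` constant ⇒ Weil type; here read on the pair
`(Ψ_{j₁}; Φ₀)`.) [cite: Deligne1982HodgeCycles, §5 (c)] -/
theorem weilTypeCount_of_pattern (hσ : orderOf σ = 6)
    (Ψ : Fin 4 → CMType K) (hΨ : SumTwo Ψ) {j₀ j₁ j₂ j₃ : Fin 4} (hnd : [j₀, j₁, j₂, j₃].Nodup)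
    {Φ₀ : CMType (IntermediateField.fixedField (Subgroup.zpowers (σ ^ 2)))}
    (hΦ₀ : Ψ j₀ = inducedCMType (algebraMap (IntermediateField.fixedField (Subgroup.zpowers (σ ^ 2))) K) Φ₀)
    (h2 : Ψ j₂ = cmTypeMap (σ ^ 2).toRingEquiv (Ψ j₁)) (h4 : Ψ j₃ = cmTypeMap (σ ^ 4).toRingEquiv (Ψ j₁))
    (τ : IntermediateField.fixedField (Subgroup.zpowers (σ ^ 2)) →+* ℂ) :
    (Finset.univ.filter fun s : K →+* ℂ =>
        s.comp (algebraMap (IntermediateField.fixedField (Subgroup.zpowers (σ ^ 2))) K) = τ ∧ s ∈ (Ψ j₁).1).card +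
      (if τ ∈ Φ₀.1 then 1 else 0) = 2 := by
  -- an extension `s₀` of `τ`
  obtain ⟨s₀, hs₀⟩ : ∃ s₀ : K →+* ℂ,
      s₀.comp (algebraMap (IntermediateField.fixedField (Subgroup.zpowers (σ ^ 2))) K) = τ :=
    ⟨ComplexEmbedding.lift K τ, ComplexEmbedding.lift_comp_algebraMap K τ⟩
  -- the twists of `s₀`
  have ht0 : s₀.comp ((σ ^ 2) ^ 0).toRingEquiv.toRingHom = s₀ := RingHom.ext fun x => by simp
  have ht1 : s₀.comp ((σ ^ 2) ^ 1).toRingEquiv.toRingHom = s₀.comp (σ ^ 2).toRingEquiv.toRingHom := by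
    rw [pow_one]
  have ht2 : s₀.comp ((σ ^ 2) ^ 2).toRingEquiv.toRingHom = s₀.comp (σ ^ 4).toRingEquiv.toRingHom := by
    rw [← pow_mul]
  -- the fibre count as a sum of three indicators
  have hcard : (Finset.univ.filter fun s : K →+* ℂ =>
        s.comp (algebraMap (IntermediateField.fixedField (Subgroup.zpowers (σ ^ 2))) K) = τ ∧
          s ∈ (Ψ j₁).1).card =
      ∑ n ∈ Finset.range 3, (if s₀.comp ((σ ^ 2) ^ n).toRingEquiv.toRingHom ∈ (Ψ j₁).1 then 1 else 0 : ℕ) := by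
    rw [← Finset.filter_filter, ← hs₀, filter_comp_algebraMap_eq_image σ hσ s₀, Finset.filter_image,
      Finset.card_image_of_injOn ((injOn_comp_pow_sq σ hσ s₀).mono (Finset.coe_subset.mpr
        (Finset.filter_subset _ _))), Finset.card_filter]
  -- the constant sum at `s₀`, re-indexed along the pattern
  have huniv : ([j₀, j₁, j₂, j₃] : List (Fin 4)).toFinset = Finset.univ :=
    Finset.eq_univ_of_card _ (by rw [List.toFinset_card_of_nodup hnd]; rfl)
  have hsum : ind (Ψ j₀) s₀ + ind (Ψ j₁) s₀ + ind (Ψ j₂) s₀ + ind (Ψ j₃) s₀ = 2 := by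
    have h' : ∑ j, ind (Ψ j) s₀ = 2 := by rw [Fin.sum_univ_four]; exact hΨ s₀
    rw [← huniv, List.sum_toFinset _ hnd] at h'
    simpa [add_assoc] using h'
  -- the four indicators
  have hi₀ : ind (Ψ j₀) s₀ = ((if τ ∈ Φ₀.1 then 1 else 0 : ℕ) : ℤ) := by
    rw [ind_eq_natCast_ite, hΦ₀]
    simp only [mem_inducedCMType_iff]
    rw [hs₀]
  have hi₁ : ind (Ψ j₁) s₀ = ((if s₀.comp ((σ ^ 2) ^ 0).toRingEquiv.toRingHom ∈ (Ψ j₁).1 then 1 else 0 : ℕ) : ℤ) := by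
    rw [ind_eq_natCast_ite, ht0]
  have hi₂ : ind (Ψ j₂) s₀ = ((if s₀.comp ((σ ^ 2) ^ 1).toRingEquiv.toRingHom ∈ (Ψ j₁).1 then 1 else 0 : ℕ) : ℤ) := by
    rw [ind_eq_natCast_ite, h2, ht1]
    simp only [mem_cmTypeMap_iff]
  have hi₃ : ind (Ψ j₃) s₀ = ((if s₀.comp ((σ ^ 2) ^ 2).toRingEquiv.toRingHom ∈ (Ψ j₁).1 then 1 else 0 : ℕ) : ℤ) := by
    rw [ind_eq_natCast_ite, h4, ht2]
    simp only [mem_cmTypeMap_iff]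
  rw [hcard, Finset.sum_range_succ, Finset.sum_range_succ, Finset.sum_range_succ, Finset.sum_range_zero, zero_add]
  rw [hi₀, hi₁, hi₂, hi₃] at hsum
  omega

/-! ## §3 The induced corner, with its inducing type retained -/

/-- **A realisation of a `σ²`-stable type is `𝓞_k`-isogenous to a power of a CM elliptic curve of the inducing
type** — `exists_cmCurve_isogeny_of_sq_stable` with the equation `Ψ = Ind_k^K Φ₀` RETAINED (so that the count
`weilTypeCount_of_pattern` applies to the same `Φ₀`): Shimura's Thm. 3 (tree `thm3_isogenousPower_of_riemann`,
kernel theorem modulo `hR`, `h₃`) on the type produced by `exists_inducedCMType_of_sq_stable`.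
[cite: Shimura1998, §6.2 Theorem 3 and §8.2] -/
theorem exists_inducedType_cmCurve_isogeny_of_sq_stable (hR : DeligneMilne1982_Thm_6_20_full)
    (h₃ : CMAbelianVarietyRealised) (h6 : Module.finrank ℚ K = 6) (hσ : orderOf σ = 6) (h3 : σ ^ 3 = conjGal)
    {Ψ : CMType K} (hΨ : cmTypeMap (σ ^ 2).toRingEquiv Ψ = Ψ)
    {A : AbelianVariety ℂ} {ι : 𝓞 K →+* End A} {θ : K →+* Module.End ℂ (complexBetti A.X 1)}
    (hA : IsCMTypeRealisation Ψ A ι θ) :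
    ∃ (Φ₀ : CMType (IntermediateField.fixedField (Subgroup.zpowers (σ ^ 2)))),
      Ψ = inducedCMType (algebraMap (IntermediateField.fixedField (Subgroup.zpowers (σ ^ 2))) K) Φ₀ ∧
      ∃ (E : AbelianVariety ℂ) (ιE : 𝓞 (IntermediateField.fixedField (Subgroup.zpowers (σ ^ 2))) →+* End E)
        (θE : IntermediateField.fixedField (Subgroup.zpowers (σ ^ 2)) →+* Module.End ℂ (complexBetti E.X 1)),
        IsCMTypeRealisation Φ₀ E ιE θE ∧ E.dim = 1 ∧
        ∃ (h : ℕ) (P : AbelianVariety ℂ) (π : Fin h → (P ⟶ E)), Nonempty (IsLimit (Fan.mk P π)) ∧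
          ∃ g : A ⟶ P, AbelianVariety.IsIsogeny g ∧
            ∀ (j : Fin h) (a : 𝓞 (IntermediateField.fixedField (Subgroup.zpowers (σ ^ 2)))),
              ι (RingOfIntegers.mapRingHom
                  (algebraMap (IntermediateField.fixedField (Subgroup.zpowers (σ ^ 2))) K) a) ≫ (g ≫ π j) =
                (g ≫ π j) ≫ ιE a := by
  haveI := isCMField_fixedField_sq σ hσ h3
  obtain ⟨Φ₀, hΦ₀⟩ := exists_inducedCMType_of_sq_stable σ Ψ hΨ
  rw [hΦ₀] at hA
  obtain ⟨E, ιE, θE, hE, h, P, π, hlim, g, hg, hcomm⟩ :=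
    thm3_isogenousPower_of_riemann hR h₃ _ K
      (algebraMap (IntermediateField.fixedField (Subgroup.zpowers (σ ^ 2))) K) Φ₀ A ι θ hA
  refine ⟨Φ₀, hΦ₀, E, ιE, θE, hE, ?_, h, P, π, hlim, g, hg, hcomm⟩
  rw [show E.dim = _ from Literature.AlgebraicGeometry.Motives.schemeDim_eq_holds hE.1,
    finrank_fixedField_sq σ h6 hσ]

end Summit.HodgeConjecture.CorCM.CyclicSextic

end
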